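import Summits.QuantumFields.YangMills.Theorems.CentreWallReflectionSlabPSD1
import HarnessLib

/-!
# Slab decomposition of the four-torus Wilson weight, VIII: positivity of the one-layer kernel (Osterwalder–Seiler, no gauge fixing) — the positivity theorem
# (crux `CentreWallReflection.WallReflection` ⟨stmt-QuantumFields-23707⟩, line `birth`, stub `stub_instantiate`; planner ym-idea-4 g18)

The Gram identity `Re tr ρ(b a⁻¹) = Σ_{ik}(Re ρ(a)_{ik} Re ρ(b)_{ik} + Im ρ(a)_{ik} Im ρ(b)_{ik})` for unitary `ρ`, gauge invariance of the
layer Gram form, the one-layer slab action of a glued configuration (two half spatial actions + temporal Gram coupling), the kernel in Gram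
form, GAUGE AVERAGING `∫e^{βΓ(A,U·A')}dU = ∫∫e^{βΓ(H·A,U·A')}dUdH`, and `slabKernel_one_psd`: `0 ≤ ∫∫ φ(A)Ψ_1(A,A')φ(A')` for bounded measurable
`φ` (Fubini to the product space `(Ω×Ω)²` and `FemtoTransferGap.integral_prod_exp_gram_nonneg`).
HONEST FRAMING: lattice bookkeeping toward ONE crux of a draft route (fixed torus, finite lattice); nothing here proves the route's target
`MarginalTwistOnset.FixedTorusCriterionFailure`, any continuum statement, or the Yang–Mills mass gap.  THEOREMS ONLY (no `def`, no `sorry`),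
standard axioms.  References: [cite: OsterwalderSeiler1978, §2]; [cite: tHooft1979]; E. T. Tomboulis, L. G. Yaffe, CMP 100 (1985) 313;
[cite: Luscher1983, §2].
-/

set_option autoImplicit false

noncomputable section

open scoped BigOperators
open MeasureTheory Literature.MathematicalPhysics.QuantumFieldTheory

namespace Summit.QuantumFields.YangMills.Theorems.CentreWallReflection.Slab

open MeasureTheory
open Literature.MathematicalPhysics.QuantumFieldTheory.LatticeRP (splice measurePreserving_splice measurable_splice)
open Summit.QuantumFields.YangMills.Theorems.FemtoTransferGap (integral_prod_exp_gram_nonneg)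

section PSDMeasure

variable {n : ℕ} {G : Type} [Group G] [TopologicalSpace G] [IsTopologicalGroup G] [CompactSpace G]
  [MeasurableSpace G] [BorelSpace G] [SecondCountableTopology G] {N : ℕ} (ρ : G →* Matrix (Fin N) (Fin N) ℂ) (μ : Fin 4)


omit [SecondCountableTopology G] in
/-- The layer multiplication preserves product Haar measure. -/
theorem measurePreserving_layerMul (H : (GaugeConfig 4 (n + 1) G)) : MeasurePreserving (layerMul (n := n) μ H) (MeasureTheory.Measure.pi (fun _ : Edge 4 (n + 1) => haarProbability G)) (MeasureTheory.Measure.pi (fun _ : Edge 4 (n + 1) => haarProbability G)) := by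
  have h := measurePreserving_pi (fun _ : Edge 4 (n + 1) => haarProbability G) (fun _ => haarProbability G)
    (f := fun e (g : G) => if e.2 = μ ∧ e.1 μ = 0 then H e * g else g) (fun e => by
      by_cases he : e.2 = μ ∧ e.1 μ = 0
      · simp only [he, and_self, if_true]; exact measurePreserving_mul_left (haarProbability G) _
      · simp only [he, if_false]; exact MeasurePreserving.id _)
  exact h

omit [CompactSpace G] [MeasurableSpace G] [BorelSpace G] [SecondCountableTopology G] in
/-- The gauge action is continuous in both arguments. -/
theorem continuous_gaugeAct : Continuous fun p : (GaugeConfig 4 (n + 1) G) × (GaugeConfig 4 (n + 1) G) => gaugeAct μ p.1 p.2 := by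
  have hev : ∀ e' : Edge 4 (n + 1), Continuous fun W : (GaugeConfig 4 (n + 1) G) => W e' := fun e' => continuous_apply e'
  refine continuous_pi fun e => ?_
  simp only [gaugeAct]
  split_ifs
  · exact (((hev _).comp continuous_fst).mul ((hev e).comp continuous_snd)).mul ((hev _).comp continuous_fst).inv
  · exact (hev e).comp continuous_snd

omit [CompactSpace G] [MeasurableSpace G] [BorelSpace G] [SecondCountableTopology G] in
/-- The gauge action along continuous arguments. -/
theorem continuous_gaugeAct₂ {X : Type*} [TopologicalSpace X] {h a : X → (GaugeConfig 4 (n + 1) G)} (hh : Continuous h) (ha : Continuous a) :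
    Continuous fun x => gaugeAct μ (h x) (a x) :=
  (continuous_gaugeAct μ).comp (hh.prodMk ha)

omit [IsTopologicalGroup G] [CompactSpace G] [MeasurableSpace G] [BorelSpace G] [SecondCountableTopology G] in
/-- The features are continuous. -/
theorem continuous_plaqFeature (hρ : Continuous ρ) (f : Plaquette 4 (n + 1) × Fin N × Fin N × Bool) :
    Continuous fun A : (GaugeConfig 4 (n + 1) G) => plaqFeature ρ μ f A := by
  unfold plaqFeature
  have hc : Continuous fun A : (GaugeConfig 4 (n + 1) G) => ρ (A (plaqEdge μ f.1)) f.2.1 f.2.2.1 :=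
    (Continuous.matrix_elem (hρ.comp (continuous_apply _)) _ _)
  split_ifs
  · exact Complex.continuous_re.comp hc
  · exact Complex.continuous_im.comp hc
  · exact continuous_const

omit [IsTopologicalGroup G] [CompactSpace G] [MeasurableSpace G] [BorelSpace G] [SecondCountableTopology G] in
/-- The Gram form is continuous in both arguments. -/
theorem continuous_plaqGram (hρ : Continuous ρ) {X : Type*} [TopologicalSpace X] {a b : X → (GaugeConfig 4 (n + 1) G)} (ha : Continuous a) (hb : Continuous b) :
    Continuous fun x => plaqGram ρ μ (a x) (b x) :=
  continuous_finsetSum _ fun f _ => ((continuous_plaqFeature ρ μ hρ f).comp ha).mul ((continuous_plaqFeature ρ μ hρ f).comp hb)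

omit [CompactSpace G] in
/-- The gauge action along measurable arguments is measurable. -/
theorem measurable_gaugeAct₂ {X : Type*} [MeasurableSpace X] {h a : X → (GaugeConfig 4 (n + 1) G)} (hh : Measurable h) (ha : Measurable a) :
    Measurable fun x => gaugeAct μ (h x) (a x) := by
  have hev : ∀ e' : Edge 4 (n + 1), Measurable fun W : (GaugeConfig 4 (n + 1) G) => W e' := fun e' => measurable_pi_apply e'
  refine measurable_pi_lambda _ fun e => ?_
  simp only [gaugeAct]
  split_ifs
  · exact (((hev _).comp hh).mul ((hev e).comp ha)).mul ((hev _).comp hh).inv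
  · exact (hev e).comp ha

omit [IsTopologicalGroup G] [CompactSpace G] in
/-- The Gram form along measurable arguments is measurable. -/
theorem measurable_plaqGram₂ (hρ : Continuous ρ) {X : Type*} [MeasurableSpace X] {a b : X → (GaugeConfig 4 (n + 1) G)} (ha : Measurable a) (hb : Measurable b) :
    Measurable fun x => plaqGram ρ μ (a x) (b x) :=
  Finset.measurable_sum _ fun f _ => ((continuous_plaqFeature ρ μ hρ f).measurable.comp ha).mul
    ((continuous_plaqFeature ρ μ hρ f).measurable.comp hb)

omit [CompactSpace G] [MeasurableSpace G] [BorelSpace G] [SecondCountableTopology G] in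
/-- `continuous_spatialHalf` (slab bookkeeping, see the module docstring). -/
theorem continuous_spatialHalf (hρ : Continuous ρ) : Continuous fun A : (GaugeConfig 4 (n + 1) G) => spatialHalf ρ μ A :=
  continuous_finsetSum _ fun p _ => continuous_const.mul (continuous_plaqCost ρ hρ p)

omit [TopologicalSpace G] [IsTopologicalGroup G] [CompactSpace G] [MeasurableSpace G] [BorelSpace G] [SecondCountableTopology G] in
/-- `spatialHalf_nonneg` (slab bookkeeping, see the module docstring). -/
theorem spatialHalf_nonneg (hU : ∀ g, ρ g ∈ Matrix.unitaryGroup (Fin N) ℂ) (A : (GaugeConfig 4 (n + 1) G)) : 0 ≤ spatialHalf ρ μ A :=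
  Finset.sum_nonneg fun p _ => mul_nonneg (by split_ifs <;> norm_num) (plaqCost_nonneg ρ hU A p)

omit [SecondCountableTopology G] in
/-- **The one-layer kernel in Gram form**: `Ψ_1(A,A') = e^{−β(sp A + sp A' + c₀)} ∫ e^{β Γ(A, U·A')} dπ(U)`. -/
theorem slabKernel_one_eq (hn : 1 ≤ n) (hU : ∀ g, ρ g ∈ Matrix.unitaryGroup (Fin N) ℂ) (β : ℝ) (A A' : (GaugeConfig 4 (n + 1) G)) :
    slabKernel ρ μ β 1 A A' = Real.exp (-(β * (spatialHalf ρ μ A + spatialHalf ρ μ A' +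
        ∑ p : Plaquette 4 (n + 1), (if isTemporal μ p = true ∧ (p.1 μ).val = 0 then (N : ℝ) else 0)))) *
      ∫ U, Real.exp (β * plaqGram ρ μ A (gaugeAct μ U A')) ∂(MeasureTheory.Measure.pi (fun _ : Edge 4 (n + 1) => haarProbability G)) := by
  unfold slabKernel
  rw [← integral_const_mul]
  refine integral_congr_ae (ae_of_all _ fun U => ?_)
  dsimp only
  rw [slabAction_one_glue ρ μ hn hU, plaqGram_eq_sum ρ μ hU, ← Real.exp_add]
  congr 1
  have hsum : ∑ p : Plaquette 4 (n + 1), (if isTemporal μ p = true ∧ (p.1 μ).val = 0 then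
      ((N : ℝ) - (ρ (gaugeAct μ U A' (plaqEdge μ p) * (A (plaqEdge μ p))⁻¹)).trace.re) else 0) =
      ∑ p : Plaquette 4 (n + 1), (if isTemporal μ p = true ∧ (p.1 μ).val = 0 then (N : ℝ) else 0) -
      ∑ p : Plaquette 4 (n + 1), (if isTemporal μ p = true ∧ (p.1 μ).val = 0 then
        (ρ (gaugeAct μ U A' (plaqEdge μ p) * (A (plaqEdge μ p))⁻¹)).trace.re else 0) := by
    rw [← Finset.sum_sub_distrib]
    refine Finset.sum_congr rfl fun p _ => ?_
    split_ifs <;> ring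
  rw [hsum]
  ring

/-- **Gauge averaging**: `∫ e^{βΓ(A, U·A')} dU = ∫∫ e^{βΓ(H·A, U·A')} dU dH`. -/
theorem integral_gram_gaugeAverage (hρ : Continuous ρ) (hU : ∀ g, ρ g ∈ Matrix.unitaryGroup (Fin N) ℂ) (β : ℝ) (A A' : (GaugeConfig 4 (n + 1) G)) :
    ∫ U, Real.exp (β * plaqGram ρ μ A (gaugeAct μ U A')) ∂(MeasureTheory.Measure.pi (fun _ : Edge 4 (n + 1) => haarProbability G)) =
      ∫ H, ∫ U, Real.exp (β * plaqGram ρ μ (gaugeAct μ H A) (gaugeAct μ U A')) ∂(MeasureTheory.Measure.pi (fun _ : Edge 4 (n + 1) => haarProbability G)) ∂(MeasureTheory.Measure.pi (fun _ : Edge 4 (n + 1) => haarProbability G)) := by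
  have hconst : ∀ H : (GaugeConfig 4 (n + 1) G), ∫ U, Real.exp (β * plaqGram ρ μ (gaugeAct μ H A) (gaugeAct μ U A')) ∂(MeasureTheory.Measure.pi (fun _ : Edge 4 (n + 1) => haarProbability G)) =
      ∫ U, Real.exp (β * plaqGram ρ μ A (gaugeAct μ U A')) ∂(MeasureTheory.Measure.pi (fun _ : Edge 4 (n + 1) => haarProbability G)) := by
    intro H
    have hm : Measurable fun U : (GaugeConfig 4 (n + 1) G) => Real.exp (β * plaqGram ρ μ (gaugeAct μ H A) (gaugeAct μ U A')) :=
      Real.continuous_exp.measurable.comp ((continuous_plaqGram ρ μ hρ continuous_const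
        (continuous_gaugeAct₂ μ continuous_id continuous_const)).measurable.const_mul β)
    rw [← integral_comp_mp (measurePreserving_layerMul μ H) hm]
    refine integral_congr_ae (ae_of_all _ fun U => ?_)
    dsimp only
    rw [gaugeAct_layerMul, plaqGram_gaugeAct ρ μ hU]
  simp_rw [hconst]
  rw [integral_const, smul_eq_mul, probReal_univ, one_mul]

/-- Bounded measurable functions on finite measure spaces are integrable (product-space version). -/
theorem integrable_of_bdd' {X : Type*} [MeasurableSpace X] {ν : Measure X} [IsFiniteMeasure ν] {f : X → ℝ} (hf : Measurable f)
    {C : ℝ} (hC : ∀ x, |f x| ≤ C) : Integrable f ν :=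
  Integrable.of_bound hf.aestronglyMeasurable C (ae_of_all _ fun x => by rw [Real.norm_eq_abs]; exact hC x)

/-- **Positivity of the one-layer kernel** (Osterwalder–Seiler link reflection positivity, integral form): for every bounded measurable
`φ`, `0 ≤ ∫∫ φ(A) Ψ_1(A, A') φ(A') dπ dπ`. -/
theorem slabKernel_one_psd (hn : 1 ≤ n) (hρ : Continuous ρ) (hU : ∀ g, ρ g ∈ Matrix.unitaryGroup (Fin N) ℂ) {β : ℝ} (hβ : 0 ≤ β)
    (φ : (GaugeConfig 4 (n + 1) G) → ℝ) (hφ : Measurable φ) (C : ℝ) (hφb : ∀ A, |φ A| ≤ C) :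
    0 ≤ ∫ A, ∫ A', φ A * slabKernel ρ μ β 1 A A' * φ A' ∂(MeasureTheory.Measure.pi (fun _ : Edge 4 (n + 1) => haarProbability G)) ∂(MeasureTheory.Measure.pi (fun _ : Edge 4 (n + 1) => haarProbability G)) := by
  have hC : 0 ≤ C := (abs_nonneg _).trans (hφb 1)
  set c₀ : ℝ := ∑ p : Plaquette 4 (n + 1), (if isTemporal μ p = true ∧ (p.1 μ).val = 0 then (N : ℝ) else 0) with hc₀
  set Φ : (GaugeConfig 4 (n + 1) G) → ℝ := fun A => φ A * Real.exp (-(β * spatialHalf ρ μ A)) with hΦ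
  have hΦm : Measurable Φ := hφ.mul (Real.continuous_exp.measurable.comp ((continuous_spatialHalf ρ μ hρ).measurable.const_mul β).neg)
  have hΦb : ∀ A, |Φ A| ≤ C := fun A => by
    rw [hΦ]; dsimp only; rw [abs_mul]
    calc |φ A| * |Real.exp (-(β * spatialHalf ρ μ A))| ≤ C * 1 :=
          mul_le_mul (hφb A) (abs_exp_neg_le_one hβ (spatialHalf_nonneg ρ μ hU A)) (abs_nonneg _) hC
      _ = C := mul_one _
  -- the four-variable integrand
  set M : ℝ := Real.exp (β * (Fintype.card (Plaquette 4 (n + 1) × Fin N × Fin N × Bool) * 1 ^ 2)) with hM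
  set G4 : (GaugeConfig 4 (n + 1) G) → (GaugeConfig 4 (n + 1) G) → (GaugeConfig 4 (n + 1) G) → (GaugeConfig 4 (n + 1) G) → ℝ := fun A H A' U =>
    Φ A * Φ A' * Real.exp (β * plaqGram ρ μ (gaugeAct μ H A) (gaugeAct μ U A')) with hG4
  have hG4m : ∀ {X : Type} [MeasurableSpace X] (a h a' u : X → (GaugeConfig 4 (n + 1) G)), Measurable a → Measurable h → Measurable a' → Measurable u →
      Measurable fun x => G4 (a x) (h x) (a' x) (u x) := by
    intro X _ a h a' u ha hh ha' hu
    exact ((hΦm.comp ha).mul (hΦm.comp ha')).mul (Real.continuous_exp.measurable.comp ((measurable_plaqGram₂ ρ μ hρ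
      (measurable_gaugeAct₂ μ hh ha) (measurable_gaugeAct₂ μ hu ha')).const_mul β))
  have hEb : ∀ A H A' U : (GaugeConfig 4 (n + 1) G), |Real.exp (β * plaqGram ρ μ (gaugeAct μ H A) (gaugeAct μ U A'))| ≤ M := by
    intro A H A' U
    rw [abs_of_pos (Real.exp_pos _), hM]
    refine Real.exp_le_exp.mpr (mul_le_mul_of_nonneg_left ?_ hβ)
    exact (le_abs_self _).trans (Summit.QuantumFields.YangMills.Theorems.FemtoTransferGap.abs_gram_le _ zero_le_one
      (fun f A => abs_plaqFeature_le_one ρ μ hU f A) _ _)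
  have hG4b : ∀ A H A' U : (GaugeConfig 4 (n + 1) G), |G4 A H A' U| ≤ C * C * M := by
    intro A H A' U
    rw [hG4]; dsimp only; rw [abs_mul, abs_mul]
    exact mul_le_mul (mul_le_mul (hΦb A) (hΦb A') (abs_nonneg _) hC) (hEb A H A' U) (abs_nonneg _) (by positivity)
  -- Step 1: the integrand pointwise
  have hpt : ∀ A A' : (GaugeConfig 4 (n + 1) G), φ A * slabKernel ρ μ β 1 A A' * φ A' = Real.exp (-(β * c₀)) * ∫ H, ∫ U, G4 A H A' U ∂(MeasureTheory.Measure.pi (fun _ : Edge 4 (n + 1) => haarProbability G)) ∂(MeasureTheory.Measure.pi (fun _ : Edge 4 (n + 1) => haarProbability G)) := by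
    intro A A'
    rw [slabKernel_one_eq ρ μ hn hU β A A', integral_gram_gaugeAverage ρ μ hρ hU β A A']
    have e1 : ∀ H : (GaugeConfig 4 (n + 1) G), ∫ U, G4 A H A' U ∂(MeasureTheory.Measure.pi (fun _ : Edge 4 (n + 1) => haarProbability G)) = Φ A * Φ A' * ∫ U, Real.exp (β * plaqGram ρ μ (gaugeAct μ H A) (gaugeAct μ U A')) ∂(MeasureTheory.Measure.pi (fun _ : Edge 4 (n + 1) => haarProbability G)) := by
      intro H; rw [hG4]; dsimp only; rw [integral_const_mul]
    simp_rw [e1]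
    rw [integral_const_mul, hΦ]; dsimp only
    rw [mul_add, mul_add, neg_add, neg_add, Real.exp_add, Real.exp_add]
    ring
  -- Step 2: the ordered quadruple integral
  have hI4 : ∫ A, ∫ A', φ A * slabKernel ρ μ β 1 A A' * φ A' ∂(MeasureTheory.Measure.pi (fun _ : Edge 4 (n + 1) => haarProbability G)) ∂(MeasureTheory.Measure.pi (fun _ : Edge 4 (n + 1) => haarProbability G)) =
      Real.exp (-(β * c₀)) * ∫ A, ∫ A', ∫ H, ∫ U, G4 A H A' U ∂(MeasureTheory.Measure.pi (fun _ : Edge 4 (n + 1) => haarProbability G)) ∂(MeasureTheory.Measure.pi (fun _ : Edge 4 (n + 1) => haarProbability G)) ∂(MeasureTheory.Measure.pi (fun _ : Edge 4 (n + 1) => haarProbability G)) ∂(MeasureTheory.Measure.pi (fun _ : Edge 4 (n + 1) => haarProbability G)) := by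
    simp_rw [hpt]
    simp_rw [integral_const_mul]
  -- Step 3: swap `A'` and `H`
  have hswap : ∀ A : (GaugeConfig 4 (n + 1) G), ∫ A', ∫ H, ∫ U, G4 A H A' U ∂(MeasureTheory.Measure.pi (fun _ : Edge 4 (n + 1) => haarProbability G)) ∂(MeasureTheory.Measure.pi (fun _ : Edge 4 (n + 1) => haarProbability G)) ∂(MeasureTheory.Measure.pi (fun _ : Edge 4 (n + 1) => haarProbability G)) = ∫ H, ∫ A', ∫ U, G4 A H A' U ∂(MeasureTheory.Measure.pi (fun _ : Edge 4 (n + 1) => haarProbability G)) ∂(MeasureTheory.Measure.pi (fun _ : Edge 4 (n + 1) => haarProbability G)) ∂(MeasureTheory.Measure.pi (fun _ : Edge 4 (n + 1) => haarProbability G)) := by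
    intro A
    have hm : Measurable (Function.uncurry fun (A' H : (GaugeConfig 4 (n + 1) G)) => ∫ U, G4 A H A' U ∂(MeasureTheory.Measure.pi (fun _ : Edge 4 (n + 1) => haarProbability G))) := by
      have h3 : Measurable fun r : ((GaugeConfig 4 (n + 1) G) × (GaugeConfig 4 (n + 1) G)) × (GaugeConfig 4 (n + 1) G) => G4 A r.1.2 r.1.1 r.2 :=
        hG4m _ _ _ _ measurable_const (measurable_snd.comp measurable_fst) (measurable_fst.comp measurable_fst) measurable_snd
      exact (h3.stronglyMeasurable.integral_prod_right' (ν := (MeasureTheory.Measure.pi (fun _ : Edge 4 (n + 1) => haarProbability G)))).measurable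
    refine integral_integral_swap (integrable_of_bdd' hm (C := C * C * M) fun q => ?_)
    have := norm_integral_le_of_norm_le_const (μ := (MeasureTheory.Measure.pi (fun _ : Edge 4 (n + 1) => haarProbability G))) (f := fun U => G4 A q.2 q.1 U) (C := C * C * M)
      (ae_of_all _ fun U => by rw [Real.norm_eq_abs]; exact hG4b _ _ _ _)
    rw [Real.norm_eq_abs, probReal_univ, mul_one] at this
    exact this
  simp_rw [hswap] at hI4
  -- Step 4: the Gram lemma on `(GaugeConfig 4 (n + 1) G) × (GaugeConfig 4 (n + 1) G)`
  have hgram := integral_prod_exp_gram_nonneg (((MeasureTheory.Measure.pi (fun _ : Edge 4 (n + 1) => haarProbability G))).prod (MeasureTheory.Measure.pi (fun _ : Edge 4 (n + 1) => haarProbability G))) (fun f (ξ : (GaugeConfig 4 (n + 1) G) × (GaugeConfig 4 (n + 1) G)) => plaqFeature ρ μ f (gaugeAct μ ξ.2 ξ.1))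
      (fun f => ((continuous_plaqFeature ρ μ hρ f).comp (continuous_gaugeAct₂ μ continuous_snd continuous_fst)).measurable) zero_le_one
      (fun f ξ => abs_plaqFeature_le_one ρ μ hU f _) (fun ξ => Φ ξ.1) (hΦm.comp measurable_fst) hC (fun ξ => hΦb _) hβ
  -- identify its integrand with `G4`
  have hFeq : (fun p : ((GaugeConfig 4 (n + 1) G) × (GaugeConfig 4 (n + 1) G)) × ((GaugeConfig 4 (n + 1) G) × (GaugeConfig 4 (n + 1) G)) => Φ p.1.1 * Real.exp (β * ∑ f, plaqFeature ρ μ f (gaugeAct μ p.1.2 p.1.1) *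
      plaqFeature ρ μ f (gaugeAct μ p.2.2 p.2.1)) * Φ p.2.1) = fun p => G4 p.1.1 p.1.2 p.2.1 p.2.2 := by
    funext p; rw [hG4]; dsimp only; rw [plaqGram]; ring
  rw [hFeq] at hgram
  -- Step 5: unfold the product integral into the iterated one
  have hF2m : Measurable fun p : ((GaugeConfig 4 (n + 1) G) × (GaugeConfig 4 (n + 1) G)) × ((GaugeConfig 4 (n + 1) G) × (GaugeConfig 4 (n + 1) G)) => G4 p.1.1 p.1.2 p.2.1 p.2.2 :=
    hG4m _ _ _ _ (measurable_fst.comp measurable_fst) (measurable_snd.comp measurable_fst) (measurable_fst.comp measurable_snd)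
      (measurable_snd.comp measurable_snd)
  have hJ : ∫ p : ((GaugeConfig 4 (n + 1) G) × (GaugeConfig 4 (n + 1) G)) × ((GaugeConfig 4 (n + 1) G) × (GaugeConfig 4 (n + 1) G)), G4 p.1.1 p.1.2 p.2.1 p.2.2 ∂((((MeasureTheory.Measure.pi (fun _ : Edge 4 (n + 1) => haarProbability G))).prod (MeasureTheory.Measure.pi (fun _ : Edge 4 (n + 1) => haarProbability G))).prod (((MeasureTheory.Measure.pi (fun _ : Edge 4 (n + 1) => haarProbability G))).prod (MeasureTheory.Measure.pi (fun _ : Edge 4 (n + 1) => haarProbability G)))) =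
      ∫ A, ∫ H, ∫ A', ∫ U, G4 A H A' U ∂(MeasureTheory.Measure.pi (fun _ : Edge 4 (n + 1) => haarProbability G)) ∂(MeasureTheory.Measure.pi (fun _ : Edge 4 (n + 1) => haarProbability G)) ∂(MeasureTheory.Measure.pi (fun _ : Edge 4 (n + 1) => haarProbability G)) ∂(MeasureTheory.Measure.pi (fun _ : Edge 4 (n + 1) => haarProbability G)) := by
    rw [integral_prod _ (integrable_of_bdd' hF2m fun p => hG4b _ _ _ _)]
    -- inner: `∫ ξ', G = ∫ A' ∫ U`
    have hin : ∀ ξ : (GaugeConfig 4 (n + 1) G) × (GaugeConfig 4 (n + 1) G), ∫ ξ' : (GaugeConfig 4 (n + 1) G) × (GaugeConfig 4 (n + 1) G), G4 ξ.1 ξ.2 ξ'.1 ξ'.2 ∂(((MeasureTheory.Measure.pi (fun _ : Edge 4 (n + 1) => haarProbability G))).prod (MeasureTheory.Measure.pi (fun _ : Edge 4 (n + 1) => haarProbability G))) = ∫ A', ∫ U, G4 ξ.1 ξ.2 A' U ∂(MeasureTheory.Measure.pi (fun _ : Edge 4 (n + 1) => haarProbability G)) ∂(MeasureTheory.Measure.pi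 (fun _ : Edge 4 (n + 1) => haarProbability G)) := by
      intro ξ
      exact integral_prod _ (integrable_of_bdd' (hG4m _ _ _ _ measurable_const measurable_const measurable_fst measurable_snd)
        fun p => hG4b _ _ _ _)
    simp_rw [hin]
    -- outer: `∫ ξ, g ξ = ∫ A ∫ H`
    have hgm : Measurable fun ξ : (GaugeConfig 4 (n + 1) G) × (GaugeConfig 4 (n + 1) G) => ∫ A', ∫ U, G4 ξ.1 ξ.2 A' U ∂(MeasureTheory.Measure.pi (fun _ : Edge 4 (n + 1) => haarProbability G)) ∂(MeasureTheory.Measure.pi (fun _ : Edge 4 (n + 1) => haarProbability G)) := by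
      have h1 : Measurable fun r : (((GaugeConfig 4 (n + 1) G) × (GaugeConfig 4 (n + 1) G)) × (GaugeConfig 4 (n + 1) G)) × (GaugeConfig 4 (n + 1) G) => G4 r.1.1.1 r.1.1.2 r.1.2 r.2 :=
        hG4m _ _ _ _ (measurable_fst.comp (measurable_fst.comp measurable_fst)) (measurable_snd.comp (measurable_fst.comp measurable_fst))
          (measurable_snd.comp measurable_fst) measurable_snd
      have h2 : Measurable fun s : ((GaugeConfig 4 (n + 1) G) × (GaugeConfig 4 (n + 1) G)) × (GaugeConfig 4 (n + 1) G) => ∫ U, G4 s.1.1 s.1.2 s.2 U ∂(MeasureTheory.Measure.pi (fun _ : Edge 4 (n + 1) => haarProbability G)) :=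
        (h1.stronglyMeasurable.integral_prod_right' (ν := (MeasureTheory.Measure.pi (fun _ : Edge 4 (n + 1) => haarProbability G)))).measurable
      exact (h2.stronglyMeasurable.integral_prod_right' (ν := (MeasureTheory.Measure.pi (fun _ : Edge 4 (n + 1) => haarProbability G)))).measurable
    have hgb : ∀ ξ : (GaugeConfig 4 (n + 1) G) × (GaugeConfig 4 (n + 1) G), |∫ A', ∫ U, G4 ξ.1 ξ.2 A' U ∂(MeasureTheory.Measure.pi (fun _ : Edge 4 (n + 1) => haarProbability G)) ∂(MeasureTheory.Measure.pi (fun _ : Edge 4 (n + 1) => haarProbability G))| ≤ C * C * M := by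
      intro ξ
      have h1 : ∀ A', |∫ U, G4 ξ.1 ξ.2 A' U ∂(MeasureTheory.Measure.pi (fun _ : Edge 4 (n + 1) => haarProbability G))| ≤ C * C * M := fun A' => by
        have := norm_integral_le_of_norm_le_const (μ := (MeasureTheory.Measure.pi (fun _ : Edge 4 (n + 1) => haarProbability G))) (f := fun U => G4 ξ.1 ξ.2 A' U) (C := C * C * M)
          (ae_of_all _ fun U => by rw [Real.norm_eq_abs]; exact hG4b _ _ _ _)
        rwa [Real.norm_eq_abs, probReal_univ, mul_one] at this
      have := norm_integral_le_of_norm_le_const (μ := (MeasureTheory.Measure.pi (fun _ : Edge 4 (n + 1) => haarProbability G))) (f := fun A' => ∫ U, G4 ξ.1 ξ.2 A' U ∂(MeasureTheory.Measure.pi (fun _ : Edge 4 (n + 1) => haarProbability G))) (C := C * C * M)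
        (ae_of_all _ fun A' => by rw [Real.norm_eq_abs]; exact h1 A')
      rwa [Real.norm_eq_abs, probReal_univ, mul_one] at this
    exact integral_prod _ (integrable_of_bdd' hgm hgb)
  rw [hJ] at hgram
  rw [hI4]
  exact mul_nonneg (Real.exp_pos _).le hgram

end PSDMeasure

end Summit.QuantumFields.YangMills.Theorems.CentreWallReflection.Slab

end
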